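import Mathlib
import HarnessLib
import Summits.HubbardSuperconductivity.HubbardSuperconductivity.Theorems.KLProgrammeKLRegimeEngineLadderLocalisation

/-!
# Route `KLProgramme` — crux K3, ENGINE child (stmt-HubbardSuperconductivity-19662 `KLRegimeEngineV7` / its gen-3 successor on `klPredsV10`):
# the VALUE-INCREMENT clauses (E2″-v6) `PairValueIncrementAtV6` and (E2′-S3) `QuarticValueIncrementAtS3` at `1 ≤ n` from the engine's
# one-slice channel ladders — the resummed ladder moves an array entry by at most `(3/2)·m′²·Σ|z′|`

Cell gate-hubbard-kl, seat hubbard-kl-k3c1-p1 (g2; technique «composed-map remainder propagation»); third of the series p461056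
`…EnginePairLadderInsertion` ((E2) `∃ w N` from true-weight ladder sums) / p463012 `…EngineLadderLocalisation` (frequency-dependent rungs, product
carrier).  The two INCREMENT clauses of the engine slot `EngineBoundsAtV7S` (`…SplitBundleV10`; texts from `…SplitBundleV8`) compare scale `n` with
scale `n − 1` at the SAME external legs: `‖𝒞_n(Qm)(k,k′) − 𝒞_{n−1}(Qm)(k,k′)‖ ≤ gainBar G P U n |Qm|_𝕋 |k−k′|_𝕋 |k+k′−Qm|_𝕋 + eremBar + thermalBar +
legDressBarQ·legSliceCountT` for EVERY total momentum `Qm` (E2″-v6), and the same for the `↑↓` quartic values `λ_n(k₁,k₂,k₃)` with the three transfers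
`k₁+k₃`, `k₁−k₂`, `k₂−k₃` (E2′-S3).  In the one-scale expansion the increment is (channel ladders with `≥ 1` slice bubble) + (everything else); a
channel ladder on its carrier `S′` (loop momentum × slice Matsubara index) with rung array `K` (`|K| ≤ m′`) and single-pair weights `z′`
(`m′·Σ|z′| ≤ 1/3`) sums to `T_K = K·N_K`, and by p457092 `klcrs_single_slice` **`|T_K(x,y) − K(x,y)| ≤ (3/2)·m′·(m′·Σ|z′|)`** at every entry — the
slice's bubble MASS in that channel at that transfer is what the gain profiles `ppGain n ρ` / `phGain n ρ` of `gainBar` majorise (times `(Klam U)²`).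
No localisation and no model weights are needed for the increments (the external entry of `K` IS the scale-`(n−1)` value).

§1 `klvi_ladderSum_entry_bounds` (abstract: `|T_K(x,y)| ≤ (3/2)m′`, `|T_K(x,y) − K(x,y)| ≤ (3/2)m′²Σ|z′|` for ANY matrix summing the ladder series).
§2 **`pairValueIncrementAtV6_of_expansion`**: (E2″-v6) at `1 ≤ n` from, per `Qm`, ONE pp-channel ladder `(K, z′, T_K, m′)` on `TorusSite 2 L × F` with
external index `a₀ : F` and the per-entry accounting `‖𝒞_n(Qm)(k,k′) − T_K((k,a₀),(k′,a₀))‖ + ‖K((k,a₀),(k′,a₀)) − 𝒞_{n−1}(Qm)(k,k′)‖ + (3/2)m′²Σ|z′| ≤`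
the clause's right-hand side.  §3 **`quarticValueIncrementAtS3_of_expansion`**: (E2′-S3) at `1 ≤ n` from, per leg triple, THREE channel ladders
(pp, ph-direct, ph-exchange) with engine-chosen external index pairs and the accounting `‖λ_n − λ_{n−1} − Σ_ch (T_ch(x_ch,y_ch) − K_ch(x_ch,y_ch))‖ +
Σ_ch (3/2)m_ch²Σ|z_ch| ≤` the clause's right-hand side.  Everything is proved; no definitions; nothing about the model is asserted beyond these
implications.  0 kit.
-/

noncomputable section

namespace Summit.HubbardSuperconductivity.HubbardSuperconductivity.Theorems.KLRegimeSplit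

set_option linter.dupNamespace false -- summit = problem name (single-conjunct summit), D-0017

open Finset Matrix Literature.MathematicalPhysics.QuantumLattice Literature.Probability.LatticeModels
open Summit.HubbardSuperconductivity.HubbardSuperconductivity.Theorems.KLProgrammeCooperResummation

/-! ## §1 Entry bounds of a one-slice ladder sum -/

section Abstract

variable {S : Type*} [Fintype S] [DecidableEq S] [Nonempty S]

/-- **Entry bounds of the one-slice ladder sum.**  `|X| ≤ m`, weights `z` with `m·Σ|z| ≤ 1/3`, `T` ANY matrix summing `Σ_j X(−diag z·X)^j`:
`|T(x,y)| ≤ (3/2)m` and `|T(x,y) − X(x,y)| ≤ (3/2)m·(m·Σ|z|)` (the ladder with at least one bubble is second order in the rung times the mass). -/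
theorem klvi_ladderSum_entry_bounds (X : Matrix S S ℂ) (z : S → ℂ) {m : ℝ} (hm : 0 ≤ m) (hX : ∀ x y, ‖X x y‖ ≤ m)
    (hz : m * ∑ a, ‖z a‖ ≤ 1 / 3) (T : Matrix S S ℂ) (hT : HasSum (fun j : ℕ => X * (-(Matrix.diagonal z * X)) ^ j) T)
    (x y : S) : ‖T x y‖ ≤ 3 / 2 * m ∧ ‖T x y - X x y‖ ≤ 3 / 2 * m * (m * ∑ a, ‖z a‖) := by
  obtain ⟨N, -, hN1, -, -, -, -, -, -, hXN, hXNX, -⟩ := klcrs_single_slice z hm X hX hz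
  have hT' : T = X * N := hT.unique (klcrs_single_slice_ladder_hasSum z hm X hX hz N hN1).2
  subst hT'
  exact ⟨hXN x y, by rw [← Matrix.sub_apply]; exact hXNX x y⟩

end Abstract

/-! ## §2 (E2″-v6) from one pp-channel ladder per total momentum -/

section Model

variable (L M : ℕ) [NeZero L] [NeZero M]
variable {F : Type*} [Fintype F] [DecidableEq F] [Nonempty F]

/-- **(E2″-v6) at `1 ≤ n` from the engine's pp-channel ladders.**  Fix the slice-frequency index type `F` and the external index `a₀ : F`.  If for
every total momentum `Qm` the engine supplies the rung array `K` on `TorusSite 2 L × F` (`|K| ≤ m′`), single-pair weights `z′` (`m′·Σ|z′| ≤ 1/3`),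
the ladder sum `T_K`, and for all `k, k′` in the ball the accounting
`‖𝒞_n(Qm)(k,k′) − T_K((k,a₀),(k′,a₀))‖ + ‖K((k,a₀),(k′,a₀)) − 𝒞_{n−1}(Qm)(k,k′)‖ + (3/2)m′(m′Σ|z′|) ≤ gainBar G P U n |Qm|_𝕋 |k−k′|_𝕋 |k+k′−Qm|_𝕋 +
eremBar G P Q U β L (n−1) + thermalBar G P U β n + legDressBarQ G P Q U n (legSliceCountT … n (k′, Qm−k′, Qm−k, k))` (non-ladder part + rung
localisation at the external entry + the ladder's own size against the pp gain), then `PairValueIncrementAtV6 L M G P Q β U μ K₀ n`. -/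
theorem pairValueIncrementAtV6_of_expansion {G : GeoConsts} {P : SplitConsts} {Q : EngConsts} {β U μ : ℝ} {K₀ : TrigPolyC4v} {n : ℕ}
    (a₀ : F)
    (hexp : ∀ Qm : TorusSite 2 L,
      ∃ (K : Matrix (TorusSite 2 L × F) (TorusSite 2 L × F) ℂ) (z' : TorusSite 2 L × F → ℂ)
        (TK : Matrix (TorusSite 2 L × F) (TorusSite 2 L × F) ℂ) (m' : ℝ),
        0 ≤ m' ∧ (∀ x y, ‖K x y‖ ≤ m') ∧ m' * ∑ x, ‖z' x‖ ≤ 1 / 3 ∧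
        HasSum (fun j : ℕ => K * (-(Matrix.diagonal z' * K)) ^ j) TK ∧
        ∀ k ∈ klBall L μ K₀, ∀ k' ∈ klBall L μ K₀,
          ‖klPairAmplitude L M β U μ K₀ n Qm k k' - TK (k, a₀) (k', a₀)‖ +
              ‖K (k, a₀) (k', a₀) - klPairAmplitude L M β U μ K₀ (n - 1) Qm k k'‖ + 3 / 2 * m' * (m' * ∑ x, ‖z' x‖) ≤
            gainBar G P U n (klTorusNorm L Qm) (klTorusNorm L (k - k')) (klTorusNorm L (k + k' - Qm)) +
              eremBar G P Q U β L (n - 1) + thermalBar G P U β n +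
                legDressBarQ G P Q U n (legSliceCountT L β μ K₀ n ![k', Qm - k', Qm - k, k])) :
    PairValueIncrementAtV6 L M G P Q β U μ K₀ n := by
  intro _ Qm k hk k' hk'
  obtain ⟨K, z', TK, m', hm', hK, hz, hTK, hacc⟩ := hexp Qm
  have h := hacc k hk k' hk'
  have hmid := (klvi_ladderSum_entry_bounds K z' hm' hK hz TK hTK (k, a₀) (k', a₀)).2
  have htri : ‖klPairAmplitude L M β U μ K₀ n Qm k k' - klPairAmplitude L M β U μ K₀ (n - 1) Qm k k'‖ ≤
      ‖klPairAmplitude L M β U μ K₀ n Qm k k' - TK (k, a₀) (k', a₀)‖ + ‖TK (k, a₀) (k', a₀) - K (k, a₀) (k', a₀)‖ +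
        ‖K (k, a₀) (k', a₀) - klPairAmplitude L M β U μ K₀ (n - 1) Qm k k'‖ := by
    calc ‖klPairAmplitude L M β U μ K₀ n Qm k k' - klPairAmplitude L M β U μ K₀ (n - 1) Qm k k'‖
        = ‖(klPairAmplitude L M β U μ K₀ n Qm k k' - TK (k, a₀) (k', a₀)) + (TK (k, a₀) (k', a₀) - K (k, a₀) (k', a₀)) +
            (K (k, a₀) (k', a₀) - klPairAmplitude L M β U μ K₀ (n - 1) Qm k k')‖ := by rw [sub_add_sub_cancel, sub_add_sub_cancel]
      _ ≤ _ := (norm_add_le _ _).trans (add_le_add (norm_add_le _ _) le_rfl)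
  linarith

/-! ## §3 (E2′-S3) from three channel ladders per leg triple -/

/-- **(E2′-S3) at `1 ≤ n` from the engine's three channel ladders.**  For every leg triple `k₁, k₂, k₃` in the ball the engine supplies, for each
channel `ch ∈ {pp at k₁+k₃, ph-direct at k₁−k₂, ph-exchange at k₂−k₃}`, a rung array `K_ch` on `TorusSite 2 L × F` (`|K_ch| ≤ m_ch`), single-pair
weights `z_ch` (`m_ch·Σ|z_ch| ≤ 1/3`), the ladder sum `T_ch` and an external index pair `(x_ch, y_ch)`, together with the accounting
`‖λ_n(k₁,k₂,k₃) − λ_{n−1}(k₁,k₂,k₃) − Σ_ch (T_ch(x_ch,y_ch) − K_ch(x_ch,y_ch))‖ + Σ_ch (3/2)m_ch(m_chΣ|z_ch|) ≤ gainBar G P U n |k₁+k₃|_𝕋 |k₁−k₂|_𝕋 |k₂−k₃|_𝕋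
+ eremBar G P Q U β L (n−1) + thermalBar G P U β n + legDressBarQ G P Q U n (legSliceCountT … n (k₁, k₂, k₃, k₁−k₂+k₃))` (the expansion identity's
non-ladder rest + the three ladders' own sizes against the three gains); then `QuarticValueIncrementAtS3 L M G P Q β U μ K₀ n`. -/
theorem quarticValueIncrementAtS3_of_expansion {G : GeoConsts} {P : SplitConsts} {Q : EngConsts} {β U μ : ℝ} {K₀ : TrigPolyC4v} {n : ℕ}
    (hexp : ∀ k₁ ∈ klBall L μ K₀, ∀ k₂ ∈ klBall L μ K₀, ∀ k₃ ∈ klBall L μ K₀,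
      ∃ (Kp Kd Kx : Matrix (TorusSite 2 L × F) (TorusSite 2 L × F) ℂ) (zp zd zx : TorusSite 2 L × F → ℂ)
        (Tp Td Tx : Matrix (TorusSite 2 L × F) (TorusSite 2 L × F) ℂ) (mp md mx : ℝ) (xp yp xd yd xx yx : TorusSite 2 L × F),
        (0 ≤ mp ∧ (∀ x y, ‖Kp x y‖ ≤ mp) ∧ mp * ∑ x, ‖zp x‖ ≤ 1 / 3 ∧
          HasSum (fun j : ℕ => Kp * (-(Matrix.diagonal zp * Kp)) ^ j) Tp) ∧
        (0 ≤ md ∧ (∀ x y, ‖Kd x y‖ ≤ md) ∧ md * ∑ x, ‖zd x‖ ≤ 1 / 3 ∧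
          HasSum (fun j : ℕ => Kd * (-(Matrix.diagonal zd * Kd)) ^ j) Td) ∧
        (0 ≤ mx ∧ (∀ x y, ‖Kx x y‖ ≤ mx) ∧ mx * ∑ x, ‖zx x‖ ≤ 1 / 3 ∧
          HasSum (fun j : ℕ => Kx * (-(Matrix.diagonal zx * Kx)) ^ j) Tx) ∧
        ‖klQuarticValue L M β U μ K₀ n 0 1 k₁ k₂ k₃ - klQuarticValue L M β U μ K₀ (n - 1) 0 1 k₁ k₂ k₃ -
              ((Tp xp yp - Kp xp yp) + (Td xd yd - Kd xd yd) + (Tx xx yx - Kx xx yx))‖ +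
            3 / 2 * mp * (mp * ∑ x, ‖zp x‖) + 3 / 2 * md * (md * ∑ x, ‖zd x‖) + 3 / 2 * mx * (mx * ∑ x, ‖zx x‖) ≤
          gainBar G P U n (klTorusNorm L (k₁ + k₃)) (klTorusNorm L (k₁ - k₂)) (klTorusNorm L (k₂ - k₃)) +
            eremBar G P Q U β L (n - 1) + thermalBar G P U β n +
              legDressBarQ G P Q U n (legSliceCountT L β μ K₀ n ![k₁, k₂, k₃, k₁ - k₂ + k₃])) :
    QuarticValueIncrementAtS3 L M G P Q β U μ K₀ n := by
  intro _ k₁ hk₁ k₂ hk₂ k₃ hk₃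
  obtain ⟨Kp, Kd, Kx, zp, zd, zx, Tp, Td, Tx, mp, md, mx, xp, yp, xd, yd, xx, yx, ⟨hmp, hKp, hzp, hTp⟩, ⟨hmd, hKd, hzd, hTd⟩,
    ⟨hmx, hKx, hzx, hTx⟩, hacc⟩ := hexp k₁ hk₁ k₂ hk₂ k₃ hk₃
  have hp := (klvi_ladderSum_entry_bounds Kp zp hmp hKp hzp Tp hTp xp yp).2
  have hd := (klvi_ladderSum_entry_bounds Kd zd hmd hKd hzd Td hTd xd yd).2
  have hx := (klvi_ladderSum_entry_bounds Kx zx hmx hKx hzx Tx hTx xx yx).2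
  set Δ : ℂ := klQuarticValue L M β U μ K₀ n 0 1 k₁ k₂ k₃ - klQuarticValue L M β U μ K₀ (n - 1) 0 1 k₁ k₂ k₃ with hΔ_def
  set Lad : ℂ := (Tp xp yp - Kp xp yp) + (Td xd yd - Kd xd yd) + (Tx xx yx - Kx xx yx) with hLad_def
  have hLad : ‖Lad‖ ≤ 3 / 2 * mp * (mp * ∑ x, ‖zp x‖) + 3 / 2 * md * (md * ∑ x, ‖zd x‖) + 3 / 2 * mx * (mx * ∑ x, ‖zx x‖) :=
    calc ‖Lad‖ ≤ ‖(Tp xp yp - Kp xp yp) + (Td xd yd - Kd xd yd)‖ + ‖Tx xx yx - Kx xx yx‖ := norm_add_le _ _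
      _ ≤ ‖Tp xp yp - Kp xp yp‖ + ‖Td xd yd - Kd xd yd‖ + ‖Tx xx yx - Kx xx yx‖ := add_le_add (norm_add_le _ _) le_rfl
      _ ≤ _ := by linarith
  have htri : ‖Δ‖ ≤ ‖Δ - Lad‖ + ‖Lad‖ := by
    calc ‖Δ‖ = ‖(Δ - Lad) + Lad‖ := by rw [sub_add_cancel]
      _ ≤ ‖Δ - Lad‖ + ‖Lad‖ := norm_add_le _ _
  linarith

end Model

end Summit.HubbardSuperconductivity.HubbardSuperconductivity.Theorems.KLRegimeSplit

end
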